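import Summits.CriticalPhenomena.PercolationContinuityZ3.Theorems.PercNearOneGluingNoHeavyLowerTailKNGoodGMgcTheoremB
import Summits.CriticalPhenomena.PercolationContinuityZ3.Theorems.PercNearOneGluingNoHeavyLowerTailKNGoodGMgcFM
import HarnessLib

/-!
# THEOREM B — the two-multiplier certificate for every designee position, in semantic-ready form
# (`NoHeavyLowerTail` cell, stmt-CriticalPhenomena-4575; prover `prim-hp-2`, gen 17)

Support file (`--supports stmt-CriticalPhenomena-4575`; two small definitions `phiCoef`, `worldQ` (names for the expectations) and
33 tiny COMPUTATIONAL sign checks (`native_decide` on 2 048-leaf tensors); no named facts, no sorries).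
Combines `KNGoodGMgc.theoremB_certificates` (the 27 polynomial conditions, `…KNGoodGMgcTheoremB`) with the Fourier–Motzkin algebra
`fm_j1/2/3` (`…KNGoodGMgcFM`).  With `Φ_v(j;r)(x) := phiCoef j r v x` (expectation of the f-table/pocket value `phiHat`) and
`Q_π(x) := worldQ π x` (expectation of the world indicator `qHat [π]`; `π = 0,3,5,6` ↔ `d,12,13,23`), for every `x ∈ [0,1]¹²` and all core
scalars `(α,β,γ,δ,ε)` in the cone `𝒞₅` that satisfy the two loneliness rows of `j` (world-law form, MEMO-gen15 §3b):
  `certificate_j1 : 0 ≤ Q₁₂Q₁₃ · Σ_v Φ_v(1;r) v`,  `certificate_j2 : 0 ≤ Q₁₂Q₂₃(Q_d+Q₂₃) · Σ_v Φ_v(2;r) v`,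
  `certificate_j3 : 0 ≤ Q₁₂Q₁₃Q₂₃(Q_d+Q₂₃) · Σ_v Φ_v(3;r) v`.
What remains for THEOREM B proper (next generation, gen-17 memo §4): `Σ_v Φ_v(j;r)(x) v(core) = Φ(K/B,o*;j)` ((σ,S)-expansion of the
two-vertex observer side), `Q_π(x) = ` the world law of `K`'s side, the rows from loneliness of `j`, the cone from the tree
(`KNGoodGain.*`), and `D_j > 0` (interior hair weights; boundary by continuity).
-/

namespace Summit.CriticalPhenomena.PercolationContinuityZ3.Theorems

namespace KNGoodGMgc

open SBTens

/-- `Φ_v(j;r)` as a function of the twelve side parameters: the expectation of the `v`-component of `phiHat j r`. [this work] -/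
noncomputable def phiCoef (j r : ℕ) (v : Fin 5) (x : ℕ → ℝ) : ℝ := bexp 11 (fun c => phiHat j r c v) x

/-- `Q_π` as a function of the twelve side parameters: the expectation of the world indicator `qHat [π]`. [this work] -/
noncomputable def worldQ (π : ℕ) (x : ℕ → ℝ) : ℝ := bexp 12 (qHat [π]) x

/-! ## Small facts: nonnegativity of expectations of nonnegative integrands, splitting of world lists, factor tables -/

/-- A pointwise nonnegative integrand has nonnegative expectation on the box. [folklore] -/
theorem bexp_nonneg_of_pointwise : ∀ (n : ℕ) (f : Cfg → ℤ), (∀ c, 0 ≤ f c) → ∀ x : ℕ → ℝ, (∀ i, 0 ≤ x i ∧ x i ≤ 1) → 0 ≤ bexp n f x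
  | 0, f, hf, x, _ => by rw [bexp_zero]; exact_mod_cast hf _
  | n + 1, f, hf, x, hx => by
    rw [bexp_succ]
    have h0 := bexp_nonneg_of_pointwise n _ (fun c => hf (Function.update c n false)) x hx
    have h1 := bexp_nonneg_of_pointwise n _ (fun c => hf (Function.update c n true)) x hx
    have := hx n
    nlinarith

/-- World laws are nonnegative. [this work] -/
theorem worldQ_nonneg (π : ℕ) (x : ℕ → ℝ) (hx : ∀ i, 0 ≤ x i ∧ x i ≤ 1) : 0 ≤ worldQ π x :=
  bexp_nonneg_of_pointwise 12 _ (fun c => by unfold qHat; split_ifs <;> norm_num) x hx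

/-- Indicator of a two-element world list splits. [this work] -/
theorem qHat_pair (a b : ℕ) (hab : a ≠ b) (c : Cfg) : qHat [a, b] c = qHat [a] c + qHat [b] c := by
  simp only [qHat, List.mem_cons, List.not_mem_nil, or_false]
  split_ifs <;> omega

/-- `Q_d + Q₂₃` as one expectation. [this work] -/
theorem bexp_qHat_d23 (x : ℕ → ℝ) : bexp 12 (qHat [0, 6]) x = worldQ 0 x + worldQ 6 x := by
  have : qHat [0, 6] = fun c => qHat [0] c + qHat [6] c := by funext c; exact qHat_pair 0 6 (by norm_num) c
  rw [this, bexp_add]; rfl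

section signs
/-! Sign pattern of the target coefficients (memo §3b: `j=1: (+,+,−,+,−)`, `j=2: (−,+,+,−,−)`, `j=3: (−,−,−,−,+)`), the parts used by `fm_j*`,
as coefficient checks (COMPUTATIONAL, 2 048 leaves each). -/

/-- `Φ_γ(1;1) ≤ 0` (check). [this work] -/
theorem sg_1_1 : allNonneg 11 (smul 11 (-1) (ofFn 11 fun c => phiHat 1 1 c 2)) = true := by native_decide
/-- `Φ_γ(1;2) ≤ 0` (check). [this work] -/
theorem sg_1_2 : allNonneg 11 (smul 11 (-1) (ofFn 11 fun c => phiHat 1 2 c 2)) = true := by native_decide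
/-- `Φ_γ(1;3) ≤ 0` (check). [this work] -/
theorem sg_1_3 : allNonneg 11 (smul 11 (-1) (ofFn 11 fun c => phiHat 1 3 c 2)) = true := by native_decide
/-- `Φ_ε(1;1) ≤ 0` (check). [this work] -/
theorem se_1_1 : allNonneg 11 (smul 11 (-1) (ofFn 11 fun c => phiHat 1 1 c 4)) = true := by native_decide
/-- `Φ_ε(1;2) ≤ 0` (check). [this work] -/
theorem se_1_2 : allNonneg 11 (smul 11 (-1) (ofFn 11 fun c => phiHat 1 2 c 4)) = true := by native_decide
/-- `Φ_ε(1;3) ≤ 0` (check). [this work] -/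
theorem se_1_3 : allNonneg 11 (smul 11 (-1) (ofFn 11 fun c => phiHat 1 3 c 4)) = true := by native_decide
/-- `Φ_δ(2;1) ≤ 0` (check). [this work] -/
theorem sd_2_1 : allNonneg 11 (smul 11 (-1) (ofFn 11 fun c => phiHat 2 1 c 3)) = true := by native_decide
/-- `Φ_δ(2;2) ≤ 0` (check). [this work] -/
theorem sd_2_2 : allNonneg 11 (smul 11 (-1) (ofFn 11 fun c => phiHat 2 2 c 3)) = true := by native_decide
/-- `Φ_δ(2;3) ≤ 0` (check). [this work] -/
theorem sd_2_3 : allNonneg 11 (smul 11 (-1) (ofFn 11 fun c => phiHat 2 3 c 3)) = true := by native_decide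
/-- `Φ_α(2;1)+Φ_δ(2;1) ≤ 0` (check). [this work] -/
theorem sad_2_1 : allNonneg 11 (smul 11 (-1) (ofFn 11 fun c => phiHat 2 1 c 0 + phiHat 2 1 c 3)) = true := by native_decide
/-- `Φ_α(2;2)+Φ_δ(2;2) ≤ 0` (check). [this work] -/
theorem sad_2_2 : allNonneg 11 (smul 11 (-1) (ofFn 11 fun c => phiHat 2 2 c 0 + phiHat 2 2 c 3)) = true := by native_decide
/-- `Φ_α(2;3)+Φ_δ(2;3) ≤ 0` (check). [this work] -/
theorem sad_2_3 : allNonneg 11 (smul 11 (-1) (ofFn 11 fun c => phiHat 2 3 c 0 + phiHat 2 3 c 3)) = true := by native_decide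
/-- `Φ_ε(2;1) ≤ 0` (check). [this work] -/
theorem se_2_1 : allNonneg 11 (smul 11 (-1) (ofFn 11 fun c => phiHat 2 1 c 4)) = true := by native_decide
/-- `Φ_ε(2;2) ≤ 0` (check). [this work] -/
theorem se_2_2 : allNonneg 11 (smul 11 (-1) (ofFn 11 fun c => phiHat 2 2 c 4)) = true := by native_decide
/-- `Φ_ε(2;3) ≤ 0` (check). [this work] -/
theorem se_2_3 : allNonneg 11 (smul 11 (-1) (ofFn 11 fun c => phiHat 2 3 c 4)) = true := by native_decide
/-- `Φ_δ(3;1) ≤ 0` (check). [this work] -/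
theorem sd_3_1 : allNonneg 11 (smul 11 (-1) (ofFn 11 fun c => phiHat 3 1 c 3)) = true := by native_decide
/-- `Φ_δ(3;2) ≤ 0` (check). [this work] -/
theorem sd_3_2 : allNonneg 11 (smul 11 (-1) (ofFn 11 fun c => phiHat 3 2 c 3)) = true := by native_decide
/-- `Φ_δ(3;3) ≤ 0` (check). [this work] -/
theorem sd_3_3 : allNonneg 11 (smul 11 (-1) (ofFn 11 fun c => phiHat 3 3 c 3)) = true := by native_decide
/-- `Φ_α(3;1)+Φ_δ(3;1) ≤ 0` (check). [this work] -/
theorem sad_3_1 : allNonneg 11 (smul 11 (-1) (ofFn 11 fun c => phiHat 3 1 c 0 + phiHat 3 1 c 3)) = true := by native_decide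
/-- `Φ_α(3;2)+Φ_δ(3;2) ≤ 0` (check). [this work] -/
theorem sad_3_2 : allNonneg 11 (smul 11 (-1) (ofFn 11 fun c => phiHat 3 2 c 0 + phiHat 3 2 c 3)) = true := by native_decide
/-- `Φ_α(3;3)+Φ_δ(3;3) ≤ 0` (check). [this work] -/
theorem sad_3_3 : allNonneg 11 (smul 11 (-1) (ofFn 11 fun c => phiHat 3 3 c 0 + phiHat 3 3 c 3)) = true := by native_decide
/-- `Φ_γ(3;1) ≤ 0` (check). [this work] -/
theorem sg_3_1 : allNonneg 11 (smul 11 (-1) (ofFn 11 fun c => phiHat 3 1 c 2)) = true := by native_decide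
/-- `Φ_γ(3;2) ≤ 0` (check). [this work] -/
theorem sg_3_2 : allNonneg 11 (smul 11 (-1) (ofFn 11 fun c => phiHat 3 2 c 2)) = true := by native_decide
/-- `Φ_γ(3;3) ≤ 0` (check). [this work] -/
theorem sg_3_3 : allNonneg 11 (smul 11 (-1) (ofFn 11 fun c => phiHat 3 3 c 2)) = true := by native_decide
end signs

/-! ## The certificates -/

/-- **Certificate at `j = 1`** with explicit sign hypotheses (any `r`). [this work] -/
theorem certificate_j1_of_signs (r : ℕ) (hr : r = 1 ∨ r = 2 ∨ r = 3) (x : ℕ → ℝ) (hx : ∀ i, 0 ≤ x i ∧ x i ≤ 1)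
    (sg : phiCoef 1 r 2 x ≤ 0) (se : phiCoef 1 r 4 x ≤ 0)
    (α β γ δ ε : ℝ) (hα : 0 ≤ α) (hβ : 0 ≤ β) (hδ : α ≤ δ)
    (h2 : 0 ≤ worldQ 0 x * α - worldQ 5 x * γ + worldQ 6 x * δ)
    (h3 : 0 ≤ worldQ 0 x * (α + β) - worldQ 3 x * ε + worldQ 6 x * δ) :
    0 ≤ worldQ 3 x * worldQ 5 x *
      (phiCoef 1 r 0 x * α + phiCoef 1 r 1 x * β + phiCoef 1 r 2 x * γ + phiCoef 1 r 3 x * δ + phiCoef 1 r 4 x * ε) := by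
  obtain ⟨Ba, Bd⟩ := theoremB_certificates 1 r (Or.inl rfl) hr false x hx
  obtain ⟨-, Bad⟩ := theoremB_certificates 1 r (Or.inl rfl) hr true x hx
  have eX : bexp 11 (facX 1 r false) x = -phiCoef 1 r 2 x ∧ bexp 11 (facX 1 r true) x = -phiCoef 1 r 2 x := by
    constructor <;> (rw [show facX 1 r _ = fun c => -(phiHat 1 r c 2) by funext c; simp [facX], bexp_neg]; rfl)
  have eY : bexp 11 (facY 1 r) x = -phiCoef 1 r 4 x := by
    rw [show facY 1 r = fun c => -(phiHat 1 r c 4) by funext c; simp [facY], bexp_neg]; rfl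
  have eGd : bexp 11 (facG 1 r false) x = phiCoef 1 r 3 x := by
    rw [show facG 1 r false = fun c => phiHat 1 r c 3 by funext c; simp [facG]]; rfl
  have eGad : bexp 11 (facG 1 r true) x = phiCoef 1 r 0 x + phiCoef 1 r 3 x := by
    rw [show facG 1 r true = fun c => phiHat 1 r c 0 + phiHat 1 r c 3 by funext c; simp [facG], bexp_add]; rfl
  have eU : ∀ ad, bexp 12 (qHat (facU 1 ad)) x = worldQ 5 x := fun ad => by simp [facU, worldQ]
  have eV : bexp 12 (qHat (facV 1)) x = worldQ 3 x := by simp [facV, worldQ]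
  have eWd : bexp 12 (qHat (facW 1 false)) x = worldQ 6 x := by simp [facW, worldQ]
  have eWad : bexp 12 (qHat (facW 1 true)) x = worldQ 0 x + worldQ 6 x := by
    simp only [facW]; exact bexp_qHat_d23 x
  rw [eX.1, eY, eGd, eU, eV, eWd] at Bd
  rw [eX.2, eY, eGad, eU, eV, eWad] at Bad
  have hQ12 := worldQ_nonneg 3 x hx
  have hQ13 := worldQ_nonneg 5 x hx
  exact fm_j1 _ _ _ _ _ _ _ _ _ α β γ δ ε hQ12 hQ13 hα hβ hδ sg se h2 h3 Ba (by linarith) (by linarith)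

/-- **Certificate at `j = 1`** (designee = core-bottom relay): for every pocket reference `r ∈ {1,2,3}`, every `x ∈ [0,1]¹²` and all core
scalars in the cone with the two loneliness rows of relay `1`, `0 ≤ Q₁₂Q₁₃ · Σ_v Φ_v(1;r) v`. [this work] -/
theorem certificate_j1 (r : ℕ) (hr : r = 1 ∨ r = 2 ∨ r = 3) (x : ℕ → ℝ) (hx : ∀ i, 0 ≤ x i ∧ x i ≤ 1)
    (α β γ δ ε : ℝ) (hα : 0 ≤ α) (hβ : 0 ≤ β) (hδ : α ≤ δ)
    (h2 : 0 ≤ worldQ 0 x * α - worldQ 5 x * γ + worldQ 6 x * δ)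
    (h3 : 0 ≤ worldQ 0 x * (α + β) - worldQ 3 x * ε + worldQ 6 x * δ) :
    0 ≤ worldQ 3 x * worldQ 5 x *
      (phiCoef 1 r 0 x * α + phiCoef 1 r 1 x * β + phiCoef 1 r 2 x * γ + phiCoef 1 r 3 x * δ + phiCoef 1 r 4 x * ε) := by
  have hsg : phiCoef 1 r 2 x ≤ 0 := by
    rcases hr with rfl | rfl | rfl
    · exact bexp_nonpos_of_check 11 _ sg_1_1 x hx
    · exact bexp_nonpos_of_check 11 _ sg_1_2 x hx
    · exact bexp_nonpos_of_check 11 _ sg_1_3 x hx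
  have hse : phiCoef 1 r 4 x ≤ 0 := by
    rcases hr with rfl | rfl | rfl
    · exact bexp_nonpos_of_check 11 _ se_1_1 x hx
    · exact bexp_nonpos_of_check 11 _ se_1_2 x hx
    · exact bexp_nonpos_of_check 11 _ se_1_3 x hx
  exact certificate_j1_of_signs r hr x hx hsg hse α β γ δ ε hα hβ hδ h2 h3

/-- **Certificate at `j = 2`** with explicit sign hypotheses (any `r`). [this work] -/
theorem certificate_j2_of_signs (r : ℕ) (hr : r = 1 ∨ r = 2 ∨ r = 3) (x : ℕ → ℝ) (hx : ∀ i, 0 ≤ x i ∧ x i ≤ 1)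
    (sd : phiCoef 2 r 3 x ≤ 0) (sad : phiCoef 2 r 0 x + phiCoef 2 r 3 x ≤ 0) (se : phiCoef 2 r 4 x ≤ 0)
    (α β γ δ ε : ℝ) (hα : 0 ≤ α) (hβ : 0 ≤ β) (hγ : 0 ≤ γ) (hδ : α ≤ δ)
    (h1 : 0 ≤ -worldQ 0 x * α + worldQ 5 x * γ - worldQ 6 x * δ)
    (h3 : 0 ≤ worldQ 0 x * β - worldQ 3 x * ε + worldQ 5 x * γ) :
    0 ≤ worldQ 3 x * worldQ 6 x * (worldQ 0 x + worldQ 6 x) *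
      (phiCoef 2 r 0 x * α + phiCoef 2 r 1 x * β + phiCoef 2 r 2 x * γ + phiCoef 2 r 3 x * δ + phiCoef 2 r 4 x * ε) := by
  obtain ⟨Ba, Bd⟩ := theoremB_certificates 2 r (Or.inr (Or.inl rfl)) hr false x hx
  obtain ⟨-, Bad⟩ := theoremB_certificates 2 r (Or.inr (Or.inl rfl)) hr true x hx
  have eXd : bexp 11 (facX 2 r false) x = -phiCoef 2 r 3 x := by
    rw [show facX 2 r false = fun c => -(phiHat 2 r c 3) by funext c; simp [facX], bexp_neg]; rfl
  have eXad : bexp 11 (facX 2 r true) x = -(phiCoef 2 r 0 x + phiCoef 2 r 3 x) := by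
    rw [show facX 2 r true = fun c => -(phiHat 2 r c 0 + phiHat 2 r c 3) by funext c; simp [facX], bexp_neg, bexp_add]; rfl
  have eY : bexp 11 (facY 2 r) x = -phiCoef 2 r 4 x := by
    rw [show facY 2 r = fun c => -(phiHat 2 r c 4) by funext c; simp [facY], bexp_neg]; rfl
  have eG : ∀ ad, bexp 11 (facG 2 r ad) x = phiCoef 2 r 2 x := fun ad => by
    rw [show facG 2 r ad = fun c => phiHat 2 r c 2 by funext c; simp [facG]]; rfl
  have eUd : bexp 12 (qHat (facU 2 false)) x = worldQ 6 x := by simp [facU, worldQ]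
  have eUad : bexp 12 (qHat (facU 2 true)) x = worldQ 0 x + worldQ 6 x := by simp only [facU]; exact bexp_qHat_d23 x
  have eV : bexp 12 (qHat (facV 2)) x = worldQ 3 x := by simp [facV, worldQ]
  have eW : ∀ ad, bexp 12 (qHat (facW 2 ad)) x = worldQ 5 x := fun ad => by simp [facW, worldQ]
  rw [eXd, eY, eG, eUd, eV, eW] at Bd
  rw [eXad, eY, eG, eUad, eV, eW] at Bad
  have hQd := worldQ_nonneg 0 x hx
  have hQ12 := worldQ_nonneg 3 x hx
  have hQ23 := worldQ_nonneg 6 x hx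
  exact fm_j2 _ _ _ _ _ _ _ _ _ α β γ δ ε hQd hQ12 hQ23 hα hβ hγ hδ sd sad se h1 h3 Ba (by linarith) (by linarith)

/-- **Certificate at `j = 2`** (designee = core-middle relay): `0 ≤ Q₁₂Q₂₃(Q_d+Q₂₃) · Σ_v Φ_v(2;r) v` under the cone rows and the
two loneliness rows of relay `2`. [this work] -/
theorem certificate_j2 (r : ℕ) (hr : r = 1 ∨ r = 2 ∨ r = 3) (x : ℕ → ℝ) (hx : ∀ i, 0 ≤ x i ∧ x i ≤ 1)
    (α β γ δ ε : ℝ) (hα : 0 ≤ α) (hβ : 0 ≤ β) (hγ : 0 ≤ γ) (hδ : α ≤ δ)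
    (h1 : 0 ≤ -worldQ 0 x * α + worldQ 5 x * γ - worldQ 6 x * δ)
    (h3 : 0 ≤ worldQ 0 x * β - worldQ 3 x * ε + worldQ 5 x * γ) :
    0 ≤ worldQ 3 x * worldQ 6 x * (worldQ 0 x + worldQ 6 x) *
      (phiCoef 2 r 0 x * α + phiCoef 2 r 1 x * β + phiCoef 2 r 2 x * γ + phiCoef 2 r 3 x * δ + phiCoef 2 r 4 x * ε) := by
  have hsd : phiCoef 2 r 3 x ≤ 0 := by
    rcases hr with rfl | rfl | rfl
    · exact bexp_nonpos_of_check 11 _ sd_2_1 x hx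
    · exact bexp_nonpos_of_check 11 _ sd_2_2 x hx
    · exact bexp_nonpos_of_check 11 _ sd_2_3 x hx
  have hsad : phiCoef 2 r 0 x + phiCoef 2 r 3 x ≤ 0 := by
    have e : phiCoef 2 r 0 x + phiCoef 2 r 3 x = bexp 11 (fun c => phiHat 2 r c 0 + phiHat 2 r c 3) x := by
      rw [bexp_add]; rfl
    rw [e]
    rcases hr with rfl | rfl | rfl
    · exact bexp_nonpos_of_check 11 _ sad_2_1 x hx
    · exact bexp_nonpos_of_check 11 _ sad_2_2 x hx
    · exact bexp_nonpos_of_check 11 _ sad_2_3 x hx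
  have hse : phiCoef 2 r 4 x ≤ 0 := by
    rcases hr with rfl | rfl | rfl
    · exact bexp_nonpos_of_check 11 _ se_2_1 x hx
    · exact bexp_nonpos_of_check 11 _ se_2_2 x hx
    · exact bexp_nonpos_of_check 11 _ se_2_3 x hx
  exact certificate_j2_of_signs r hr x hx hsd hsad hse α β γ δ ε hα hβ hγ hδ h1 h3

/-- **Certificate at `j = 3`** with explicit sign hypotheses (any `r`). [this work] -/
theorem certificate_j3_of_signs (r : ℕ) (hr : r = 1 ∨ r = 2 ∨ r = 3) (x : ℕ → ℝ) (hx : ∀ i, 0 ≤ x i ∧ x i ≤ 1)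
    (sd : phiCoef 3 r 3 x ≤ 0) (sad : phiCoef 3 r 0 x + phiCoef 3 r 3 x ≤ 0) (sg : phiCoef 3 r 2 x ≤ 0)
    (α β γ δ ε : ℝ) (hα : 0 ≤ α) (hβ : 0 ≤ β) (hγ : 0 ≤ γ) (hδ : α ≤ δ)
    (h1 : 0 ≤ -worldQ 0 x * (α + β) + worldQ 3 x * ε - worldQ 6 x * δ)
    (h2 : 0 ≤ -worldQ 0 x * β + worldQ 3 x * ε - worldQ 5 x * γ) :
    0 ≤ worldQ 3 x * worldQ 5 x * worldQ 6 x * (worldQ 0 x + worldQ 6 x) *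
      (phiCoef 3 r 0 x * α + phiCoef 3 r 1 x * β + phiCoef 3 r 2 x * γ + phiCoef 3 r 3 x * δ + phiCoef 3 r 4 x * ε) := by
  obtain ⟨Ba, Bd⟩ := theoremB_certificates 3 r (Or.inr (Or.inr rfl)) hr false x hx
  obtain ⟨-, Bad⟩ := theoremB_certificates 3 r (Or.inr (Or.inr rfl)) hr true x hx
  have eXd : bexp 11 (facX 3 r false) x = -phiCoef 3 r 3 x := by
    rw [show facX 3 r false = fun c => -(phiHat 3 r c 3) by funext c; simp [facX], bexp_neg]; rfl
  have eXad : bexp 11 (facX 3 r true) x = -(phiCoef 3 r 0 x + phiCoef 3 r 3 x) := by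
    rw [show facX 3 r true = fun c => -(phiHat 3 r c 0 + phiHat 3 r c 3) by funext c; simp [facX], bexp_neg, bexp_add]; rfl
  have eY : bexp 11 (facY 3 r) x = -phiCoef 3 r 2 x := by
    rw [show facY 3 r = fun c => -(phiHat 3 r c 2) by funext c; simp [facY], bexp_neg]; rfl
  have eG : ∀ ad, bexp 11 (facG 3 r ad) x = phiCoef 3 r 4 x := fun ad => by
    rw [show facG 3 r ad = fun c => phiHat 3 r c 4 by funext c; simp [facG]]; rfl
  have eUd : bexp 12 (qHat (facU 3 false)) x = worldQ 6 x := by simp [facU, worldQ]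
  have eUad : bexp 12 (qHat (facU 3 true)) x = worldQ 0 x + worldQ 6 x := by simp only [facU]; exact bexp_qHat_d23 x
  have eV : bexp 12 (qHat (facV 3)) x = worldQ 5 x := by simp [facV, worldQ]
  have eW : ∀ ad, bexp 12 (qHat (facW 3 ad)) x = worldQ 3 x := fun ad => by simp [facW, worldQ]
  rw [eXd, eY, eG, eUd, eV, eW] at Bd
  rw [eXad, eY, eG, eUad, eV, eW] at Bad
  have hQd := worldQ_nonneg 0 x hx
  have hQ12 := worldQ_nonneg 3 x hx
  have hQ13 := worldQ_nonneg 5 x hx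
  have hQ23 := worldQ_nonneg 6 x hx
  have Ba' : 0 ≤ phiCoef 3 r 4 x * worldQ 0 x + phiCoef 3 r 1 x * worldQ 3 x := by unfold phiCoef worldQ; linarith
  exact fm_j3 _ _ _ _ _ _ _ _ _ α β γ δ ε hQd hQ12 hQ13 hQ23 hα hβ hγ hδ sd sad sg h1 h2 Ba' (by linarith) (by linarith)

/-- **Certificate at `j = 3`** (designee = core-top relay): `0 ≤ Q₁₂Q₁₃Q₂₃(Q_d+Q₂₃) · Σ_v Φ_v(3;r) v` under the cone rows and the
two loneliness rows of relay `3`. [this work] -/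
theorem certificate_j3 (r : ℕ) (hr : r = 1 ∨ r = 2 ∨ r = 3) (x : ℕ → ℝ) (hx : ∀ i, 0 ≤ x i ∧ x i ≤ 1)
    (α β γ δ ε : ℝ) (hα : 0 ≤ α) (hβ : 0 ≤ β) (hγ : 0 ≤ γ) (hδ : α ≤ δ)
    (h1 : 0 ≤ -worldQ 0 x * (α + β) + worldQ 3 x * ε - worldQ 6 x * δ)
    (h2 : 0 ≤ -worldQ 0 x * β + worldQ 3 x * ε - worldQ 5 x * γ) :
    0 ≤ worldQ 3 x * worldQ 5 x * worldQ 6 x * (worldQ 0 x + worldQ 6 x) *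
      (phiCoef 3 r 0 x * α + phiCoef 3 r 1 x * β + phiCoef 3 r 2 x * γ + phiCoef 3 r 3 x * δ + phiCoef 3 r 4 x * ε) := by
  have hsd : phiCoef 3 r 3 x ≤ 0 := by
    rcases hr with rfl | rfl | rfl
    · exact bexp_nonpos_of_check 11 _ sd_3_1 x hx
    · exact bexp_nonpos_of_check 11 _ sd_3_2 x hx
    · exact bexp_nonpos_of_check 11 _ sd_3_3 x hx
  have hsad : phiCoef 3 r 0 x + phiCoef 3 r 3 x ≤ 0 := by
    have e : phiCoef 3 r 0 x + phiCoef 3 r 3 x = bexp 11 (fun c => phiHat 3 r c 0 + phiHat 3 r c 3) x := by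
      rw [bexp_add]; rfl
    rw [e]
    rcases hr with rfl | rfl | rfl
    · exact bexp_nonpos_of_check 11 _ sad_3_1 x hx
    · exact bexp_nonpos_of_check 11 _ sad_3_2 x hx
    · exact bexp_nonpos_of_check 11 _ sad_3_3 x hx
  have hsg : phiCoef 3 r 2 x ≤ 0 := by
    rcases hr with rfl | rfl | rfl
    · exact bexp_nonpos_of_check 11 _ sg_3_1 x hx
    · exact bexp_nonpos_of_check 11 _ sg_3_2 x hx
    · exact bexp_nonpos_of_check 11 _ sg_3_3 x hx
  exact certificate_j3_of_signs r hr x hx hsd hsad hsg α β γ δ ε hα hβ hγ hδ h1 h2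

end KNGoodGMgc

end Summit.CriticalPhenomena.PercolationContinuityZ3.Theorems
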